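import Summits.QuantumFields.BalabanUV.Beta.FP.CombSliceUnimodular
import Summits.QuantumFields.BalabanUV.Beta.FP.KernelPeriodisationFib
import Summits.QuantumFields.BalabanUV.Beta.FP.TorusCombForest
import Summits.QuantumFields.BalabanUV.Beta.FP.TorusGaugeCovariance
import Summits.QuantumFields.BalabanUV.Beta.GAN24.FineReadoutCauchyFrame

/-!
# `BalabanUV.Beta.FP.TorusCombRows` — road «FP» for binder row D1, ROUTE T (R-FP-51), RULING R-FP-52 (2): THE ROOTED COMB FOREST OF THE TORUS BOX, THE
# COMB-COORDINATE SLICE ROWS `combRowsT`, AND THE (UNI) INSTANCE (file 2 of 2) `|det(combRowsT · D)| = 1` FOR ANY GENERATOR MATRIX READING THE LATTICE GRADIENT ON COMB BONDS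
# (the torus half promised in `FP/CombSliceUnimodular` «NOT HERE»; OFFER O-d1leaf06g16-1 (G2)+(G3), generators (G1) = gan24-leaf-05 g48's `FP/TorusGaugeCovariance.tgrad`)

HONEST DEPENDENCY (page 1, mandatory): continuum YM on T⁴ ⇐ BetaPertH ∧ nine spine estimates (0/9 proved); BetaPertH ⇐ (D1) ∧ (D4) ∧ CAP+tail;
G-an2-4 gates asym, D1 and NE2/3/4.  HONEST FRAMING (cell contract, verbatim): «discharging `BetaPertH` makes Bałaban's UV stability UNCONDITIONAL —
a real constructive-QFT result; it is NOT the continuum limit and NOT the Clay problem.»  ABSOLUTE RULE (cell charter, verbatim): «No internally-minted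
statement may enter as a cited fact. Every hypothesis is either kernel-proved in this package or a verbatim quotation of a PUBLISHED theorem with page
reference. The manuscript(s) under audit are NOT citable for their own disputed steps — they are the thing under adjudication; programme-internal
(2001/route/tribunal) claims are never citable.»  THIS MODULE is [our object — bookkeeping] + [folklore] lattice combinatorics: the comb of an2's chart (III′)
(`AxialDressingRooted.IsCombBondAt ρ N`, axis order «lower coordinates at the root first») organised as a RANKED FOREST on the sites of the torus box `pbox M`
(`KernelPeriodisationFib.Idx`), and the (UNI) hypothesis of the OWNER's `NestedStepLawOneShot.secondVar_oneShot_nestedStepLaw` (p307295 ✓) DISCHARGED for the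
colour-stripped literal by `CombSliceUnimodular.abs_det_eq_one_of_gradientRows`.  No `def … : Prop` fact, nothing cited, 0 sorry.  «not in print; our bookkeeping».

CONTENT (every `d`; blocking `N ≥ 1`, root offset `ρ` with `0 ≤ ρ_i < N` — an2's `ρ = toSite r`, `r ∈ box (d+1) N`; box `M` with `N ∣ M_i`).
* §1 = FILE 1 `FP/TorusCombForest` (the comb forest on `ℤ^{d+1}`: `rootOf`, `depth`, `axisOf`, `signOf`, `stepOf`, `baseOf`∕`tipOf`; `rootOf_stepOf`, `depth_stepOf`,
  `stepOf_mem_pbox`, `isCombBondAt_baseOf`) — imported.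
* §2 ON THE TORUS BOX: the residual parameter type `Res ρ N M := {s : ↥(pbox M) // s ≠ rootOf ρ N s}` («`λ = 0` at the block roots»), `parentT`, `combBondT`
  (the comb bond into `x` as an index of `Idx M (Fib d)`, field slot), **`combRowsT ρ N M : Matrix (Res ρ N M) (Idx M (Fib d)) ℝ`** (row `x` = the coordinate functional
  of the comb bond into `x`).
* §3 **(UNI)**: for ANY `D : Matrix (Idx M (Fib d)) ↥(pbox M) ℝ` whose rows ON THE COMB BONDS read the lattice gradient (`hD : D (combBondT x) s = [tip x = s] − [base x = s]`
  — gan24-leaf-05's `tgrad` by its one-bond lemma), **`abs_det_combRowsT_mul_eq_one : |det(combRowsT ρ N M * D.submatrix id Subtype.val)| = 1`** — the OWNER's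
  `hU₁` with `c₁ = 1` (`u`-static: `Filter.Eventually.of_forall`); `hU₂` is the same theorem on the coarse box, `hU'` the same comb at the big blocking with rows
  re-indexed (`NestedStepLawOneShot.secondVar_kkt_fromRows_reindex`).
* §4 **(UNI) AT gan24-leaf-05's `tgrad`** (`FP/TorusGaugeCovariance` p308208 ✓, the ONE definition of the colour-stripped generators): `ne_rootOf_iff_proj_ne` («non-root» here = `Torus.proj N (x − ρ) ≠ 0` there), **`tgrad_combBondT`** (the letter `hD` at `D := tgrad M`: `tgrad_inl` + `tdelta_of_mem`),
  **`abs_det_combRowsT_mul_tgrad_eq_one`**(`_of_box`),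
  **`eventually_abs_det_combRowsT_mul_tgrad_eq_one`** — the OWNER's `hU₁` with `c₁ = 1`.
NOT HERE: the generators' covariance letters `Q₁D₁ = 0`, `Q₁D₂ = D̄` (gan24-leaf-05 g48 `FP/TorusGaugeCovariance` (C1)(C2)); the
live∕dead sorting `e : Idx M (Fib d) ≃ (o ⊕ c) ⊕ t` with `t ≃ Res` and the `kkt`∕`kBig` dress (leaf-05 g23 W-d1leaf05g23-3 (2), on request); 0 estimates; 0∕4 row-D1
binders; NOT (T-ID) complete, NOT SDF, NOT D1, NOT BetaPertH, NOT continuum, NOT Clay.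
Provenance: D1 formalisation swarm LEAF PROVER 06, unit b2b-balaban-beta-d1-formalise-leaf-06 gen 16, 2026-08-21 (R-FP-52 (2) first refusal; leaf-05 W-3 (2) GO;
gan24-leaf-05 OFFER-2 «(UNI) instances read the SAME generator columns»).  No existing file touched.
-/

noncomputable section

namespace Summit.QuantumFields.BalabanUV.Beta.FP.TorusCombRows

open Finset Matrix
open scoped BigOperators
open Literature.MathematicalPhysics.QuantumFieldTheory.Balaban1983to89
open Literature.MathematicalPhysics.QuantumFieldTheory.Balaban1983to89.Beta
open AffineAveraging (Site box toSite unitVec unitVec_apply)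
open AveragingContours (blk)
open B6Lemma24Torus (pbox mem_pbox)
open OneStepResolventKernel (Fib)
open Summit.QuantumFields.BalabanUV.Beta.FP.TorusCombForest
open Summit.QuantumFields.BalabanUV.Beta.FP.KernelPeriodisationFib (Idx)
open Summit.QuantumFields.BalabanUV.Beta.FP.CombSliceUnimodular (abs_det_eq_one_of_gradientRows)
open Summit.QuantumFields.BalabanUV.Beta.FP.TorusGaugeCovariance (tgrad tgrad_inl tdelta_of_mem)
open Literature.Probability.LatticeModels (Torus.proj Torus.proj_apply)
open Summit.QuantumFields.BalabanUV.Beta.GAN24.FineReadoutCauchyFrame (toSite_mem_range)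

variable {d : ℕ}

/-! ## §2 On the torus box: residual parameters, the comb bond into a site, the comb-coordinate slice rows -/

section Torus

variable (ρ : Site (d + 1)) (N : ℕ) (M : Fin (d + 1) → ℕ)

/-- [our object — bookkeeping] **THE RESIDUAL GAUGE PARAMETERS OF THE ROOTED COMB CHART ON THE TORUS BOX**: the sites of `pbox M` that are NOT block roots
(«`λ = 0` at the block roots»). -/
def Res : Type := {s : ↥(pbox M) // (s : Site (d + 1)) ≠ rootOf ρ N (s : Site (d + 1))}

/-- [folklore] finitely many residual parameters (a subtype of the finite box). -/
instance : Fintype (Res ρ N M) := by unfold Res; infer_instance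
/-- [folklore] decidable equality of residual parameters. -/
instance : DecidableEq (Res ρ N M) := by unfold Res; infer_instance

variable {ρ N M}

/-- the underlying lattice site of a residual parameter. -/
abbrev Res.site (x : Res ρ N M) : Site (d + 1) := ((x.1 : ↥(pbox M)) : Site (d + 1))

/-- a residual parameter is not a block root. -/
theorem Res.not_root (x : Res ρ N M) : x.site ≠ rootOf ρ N x.site := x.2

/-- a residual parameter lies in the box. -/
theorem Res.mem (x : Res ρ N M) : x.site ∈ pbox M := x.1.2

/-- [folklore] residual parameters are equal iff their sites are. -/
theorem Res.ext_iff' (x y : Res ρ N M) : x = y ↔ x.site = y.site :=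
  ⟨fun h => by rw [h], fun h => Subtype.ext (Subtype.ext h)⟩

variable (ρ N M)

open Classical in
/-- [our object — bookkeeping] **THE COMB PARENT** of a residual parameter: its comb predecessor if that is again a residual parameter of the box, `none` if it is the
block root (or — never, under `N ∣ M_i` — falls outside the box). -/
def parentT (x : Res ρ N M) : Option (Res ρ N M) :=
  if h : stepOf ρ N x.site ∈ pbox M ∧ stepOf ρ N x.site ≠ rootOf ρ N (stepOf ρ N x.site) then some ⟨⟨stepOf ρ N x.site, h.1⟩, h.2⟩ else none

open Classical in
/-- [our object — bookkeeping] **THE COMB BOND INTO `x` AS A TORUS INDEX** (field slot `inl (axisOf x)` at the base point; the base point is `x` itself or its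
predecessor, both in the box under `N ∣ M_i` — the fallback branch is never taken then). -/
def combBondT (x : Res ρ N M) : Idx M (Fib d) :=
  if h : baseOf ρ N x.site ∈ pbox M then (⟨baseOf ρ N x.site, h⟩, Sum.inl (axisOf ρ N x.site)) else (x.1, Sum.inl (axisOf ρ N x.site))

/-- [our object — bookkeeping] **THE COMB-COORDINATE SLICE ROWS ON THE TORUS BOX**: row `x` is the coordinate functional of the comb bond into `x`
(`1` at that field slot, `0` elsewhere) — the tree-bond rows `τ` of R-FP-52 (2), indexed by the residual parameters through «bond into `x` ↦ `x`». -/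
def combRowsT : Matrix (Res ρ N M) (Idx M (Fib d)) ℝ := fun x q => if q = combBondT ρ N M x then 1 else 0

variable {ρ N M}

/-- [folklore] the base point of the comb bond into a residual parameter lies in the box (`N ∣ M_i`). -/
theorem baseOf_mem_pbox (hN : 0 < N) (hρ : ∀ i, 0 ≤ ρ i ∧ ρ i < N) (hM : ∀ i, N ∣ M i) (x : Res ρ N M) : baseOf ρ N x.site ∈ pbox M := by
  by_cases hlt : rootOf ρ N x.site (axisOf ρ N x.site) < x.site (axisOf ρ N x.site)
  · rw [(base_tip_of_lt hlt).1]; exact stepOf_mem_pbox hN hρ hM x.mem x.not_root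
  · rw [(base_tip_of_not_lt hlt).1]; exact x.mem

/-- [folklore] the tip of the comb bond into `x` lies in the box (`N ∣ M_i`). -/
theorem tipOf_mem_pbox (hN : 0 < N) (hρ : ∀ i, 0 ≤ ρ i ∧ ρ i < N) (hM : ∀ i, N ∣ M i) (x : Res ρ N M) : tipOf ρ N x.site ∈ pbox M := by
  by_cases hlt : rootOf ρ N x.site (axisOf ρ N x.site) < x.site (axisOf ρ N x.site)
  · rw [(base_tip_of_lt hlt).2]; exact x.mem
  · rw [(base_tip_of_not_lt hlt).2]; exact stepOf_mem_pbox hN hρ hM x.mem x.not_root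

/-- [folklore] under `N ∣ M_i` the comb bond into `x` is `(baseOf x, inl (axisOf x))` (the fallback branch of `combBondT` is never taken). -/
theorem combBondT_eq (hN : 0 < N) (hρ : ∀ i, 0 ≤ ρ i ∧ ρ i < N) (hM : ∀ i, N ∣ M i) (x : Res ρ N M) :
    combBondT ρ N M x = (⟨baseOf ρ N x.site, baseOf_mem_pbox hN hρ hM x⟩, Sum.inl (axisOf ρ N x.site)) := by
  unfold combBondT; rw [dif_pos (baseOf_mem_pbox hN hρ hM x)]

/-- [folklore] **THE SLICE ROW READS ONE COORDINATE**: `(combRowsT * X) x c = X (combBondT x) c`. -/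
theorem combRowsT_mul_apply {κ : Type*} (X : Matrix (Idx M (Fib d)) κ ℝ) (x : Res ρ N M) (c : κ) :
    (combRowsT ρ N M * X) x c = X (combBondT ρ N M x) c := by
  rw [Matrix.mul_apply]
  simp only [combRowsT, ite_mul, one_mul, zero_mul]
  rw [Finset.sum_ite_eq' Finset.univ (combBondT ρ N M x) (fun q => X q c), if_pos (Finset.mem_univ _)]

/-- [folklore] the parent, when it exists, IS the predecessor. -/
theorem parentT_eq_some_iff (hN : 0 < N) (hρ : ∀ i, 0 ≤ ρ i ∧ ρ i < N) (hM : ∀ i, N ∣ M i) (x s : Res ρ N M) :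
    parentT ρ N M x = some s ↔ s.site = stepOf ρ N x.site := by
  have hmem := stepOf_mem_pbox hN hρ hM x.mem x.not_root
  unfold parentT
  by_cases hr : stepOf ρ N x.site = rootOf ρ N (stepOf ρ N x.site)
  · rw [dif_neg (fun h => h.2 hr)]
    constructor
    · intro h; exact absurd h (by simp)
    · intro h; exact absurd (h ▸ hr) s.not_root
  · rw [dif_pos ⟨hmem, hr⟩, Option.some.injEq]
    constructor
    · intro h; rw [← h]
    · intro h; exact ((Res.ext_iff' _ _).2 h.symm)

/-- [folklore] the parent is strictly closer to the root. -/
theorem depth_parentT (hN : 0 < N) (hρ : ∀ i, 0 ≤ ρ i ∧ ρ i < N) (hM : ∀ i, N ∣ M i) (x p : Res ρ N M) (h : parentT ρ N M x = some p) :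
    depth ρ N p.site < depth ρ N x.site := by
  rw [(parentT_eq_some_iff hN hρ hM x p).1 h]
  exact depth_stepOf_lt hN hρ x.not_root

end Torus

/-! ## §3 (UNI): the comb-coordinate slice is unimodular against any generator matrix reading the lattice gradient on comb bonds -/

section Uni

variable {ρ : Site (d + 1)} {N : ℕ} {M : Fin (d + 1) → ℕ}

/-- [folklore] **THE FADDEEV–POPOV MATRIX OF THE COMB SLICE IS THE SIGNED REDUCED INCIDENCE MATRIX OF THE COMB FOREST**: if the rows of `D` on the comb bonds read
the lattice gradient (`D (combBondT x) s = [tip x = s] − [base x = s]`, gan24-leaf-05's `tgrad_inl` +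
`tdelta_of_mem`), then `(combRowsT * D↾Res) x s = signOf x · ([s = x] − [parentT x = some s])`. -/
theorem combRowsT_mul_entry (hN : 0 < N) (hρ : ∀ i, 0 ≤ ρ i ∧ ρ i < N) (hM : ∀ i, N ∣ M i) (D : Matrix (Idx M (Fib d)) ↥(pbox M) ℝ)
    (hD : ∀ (x : Res ρ N M) (s : ↥(pbox M)),
      D (combBondT ρ N M x) s = (if tipOf ρ N x.site = (s : Site (d + 1)) then 1 else 0) - (if baseOf ρ N x.site = (s : Site (d + 1)) then 1 else 0))
    (x s : Res ρ N M) :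
    (combRowsT ρ N M * D.submatrix id Subtype.val) x s
      = (signOf ρ N x.site : ℝ) * ((if s = x then 1 else 0) - (if parentT ρ N M x = some s then 1 else 0)) := by
  rw [combRowsT_mul_apply, Matrix.submatrix_apply, id, hD]
  have hxs : x.site = ((s.1 : ↥(pbox M)) : Site (d + 1)) ↔ s = x := by rw [Res.ext_iff', eq_comm]
  have hps : stepOf ρ N x.site = ((s.1 : ↥(pbox M)) : Site (d + 1)) ↔ parentT ρ N M x = some s := by
    rw [eq_comm]; exact (parentT_eq_some_iff hN hρ hM x s).symm
  unfold signOf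
  by_cases hlt : rootOf ρ N x.site (axisOf ρ N x.site) < x.site (axisOf ρ N x.site)
  · rw [(base_tip_of_lt hlt).1, (base_tip_of_lt hlt).2, if_pos hlt]
    simp only [hxs, hps, Int.cast_one, one_mul]
  · rw [(base_tip_of_not_lt hlt).1, (base_tip_of_not_lt hlt).2, if_neg hlt]
    simp only [hxs, hps, Int.cast_neg, Int.cast_one, neg_one_mul, neg_sub]

/-- [folklore] **(UNI) ON THE TORUS BOX — THE COMB-COORDINATE SLICE IS UNIMODULAR**: for every generator matrix `D` reading the lattice gradient on the comb bonds,
`|det(combRowsT ρ N M * D↾Res)| = 1` — `CombSliceUnimodular.abs_det_eq_one_of_gradientRows` on the ranked forest (`depth`, `parentT`, orientation `signOf`).  With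
`D :=` gan24-leaf-05's `tgrad M` this is the OWNER's `hU₁` with `c₁ = 1` (`u`-static); at the coarse box ∕ the big blocking it is `hU₂` ∕ `hU'`. -/
theorem abs_det_combRowsT_mul_eq_one (hN : 0 < N) (hρ : ∀ i, 0 ≤ ρ i ∧ ρ i < N) (hM : ∀ i, N ∣ M i) (D : Matrix (Idx M (Fib d)) ↥(pbox M) ℝ)
    (hD : ∀ (x : Res ρ N M) (s : ↥(pbox M)),
      D (combBondT ρ N M x) s = (if tipOf ρ N x.site = (s : Site (d + 1)) then 1 else 0) - (if baseOf ρ N x.site = (s : Site (d + 1)) then 1 else 0)) :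
    |(combRowsT ρ N M * D.submatrix id Subtype.val).det| = 1 :=
  abs_det_eq_one_of_gradientRows _ (fun x => depth ρ N x.site) (parentT ρ N M) (fun x p h => depth_parentT hN hρ hM x p h)
    (fun x => (signOf ρ N x.site : ℝ)) (fun x => by unfold signOf; split_ifs <;> simp) (combRowsT_mul_entry hN hρ hM D hD)

/-- [folklore] **(UNI) IN THE OWNER's CURVE FORM**: `∀ᶠ u in 𝓝 0, |det(combRowsT * D↾Res)| = 1` (nothing moves — the colour-stripped literal). -/
theorem eventually_abs_det_combRowsT_mul_eq_one (hN : 0 < N) (hρ : ∀ i, 0 ≤ ρ i ∧ ρ i < N) (hM : ∀ i, N ∣ M i) (D : Matrix (Idx M (Fib d)) ↥(pbox M) ℝ)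
    (hD : ∀ (x : Res ρ N M) (s : ↥(pbox M)),
      D (combBondT ρ N M x) s = (if tipOf ρ N x.site = (s : Site (d + 1)) then 1 else 0) - (if baseOf ρ N x.site = (s : Site (d + 1)) then 1 else 0)) :
    ∀ᶠ _u in nhds (0 : ℝ), |(combRowsT ρ N M * D.submatrix id Subtype.val).det| = 1 :=
  Filter.Eventually.of_forall fun _ => abs_det_combRowsT_mul_eq_one hN hρ hM D hD

end Uni


/-! ## §4 (UNI) at gan24-leaf-05's torus gradient columns `tgrad` — the OWNER's `hU₁` with `c₁ = 1` -/

section Tgrad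

/-- [folklore] **«NON-ROOT» IN THE TWO CURRENCIES**: `x ≠ rootOf ρ N x` (this lineage) iff `Torus.proj N (x − ρ) ≠ 0` (gan24-leaf-05's). -/
theorem ne_rootOf_iff_proj_ne {N : ℕ} (hN : 0 < N) {ρ : Site (d + 1)} (hρ : ∀ i, 0 ≤ ρ i ∧ ρ i < N) (x : Site (d + 1)) :
    x ≠ rootOf ρ N x ↔ Torus.proj N (x - ρ) ≠ 0 := by
  rw [not_iff_not, eq_rootOf_iff_dvd hN hρ]
  constructor
  · intro h; funext i
    rw [Torus.proj_apply, Pi.sub_apply, Pi.zero_apply, ZMod.intCast_zmod_eq_zero_iff_dvd]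
    exact h i
  · intro h i
    have hi := congrFun h i
    rw [Torus.proj_apply, Pi.sub_apply, Pi.zero_apply, ZMod.intCast_zmod_eq_zero_iff_dvd] at hi
    exact hi

variable {N : ℕ} {ρ : Site (d + 1)} {M : Fin (d + 1) → ℕ}

/-- [folklore] **THE LETTER `hD` AT `D := tgrad M`**: on the comb bond into `x`, gan24-leaf-05's torus gradient column `s` reads `[tip x = s] − [base x = s]`. -/
theorem tgrad_combBondT (hN : 0 < N) (hρ : ∀ i, 0 ≤ ρ i ∧ ρ i < N) (hM : ∀ i, N ∣ M i) (x : Res ρ N M) (s : ↥(pbox M)) :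
    tgrad M (combBondT ρ N M x) s
      = (if tipOf ρ N x.site = (s : Site (d + 1)) then 1 else 0) - (if baseOf ρ N x.site = (s : Site (d + 1)) then 1 else 0) := by
  rw [combBondT_eq hN hρ hM x, tgrad_inl]
  show TorusGaugeCovariance.tdelta M (tipOf ρ N x.site) s - TorusGaugeCovariance.tdelta M (baseOf ρ N x.site) s = _
  rw [tdelta_of_mem M (tipOf_mem_pbox hN hρ hM x) s, tdelta_of_mem M (baseOf_mem_pbox hN hρ hM x) s]

/-- [folklore] **(UNI) AT THE TORUS GRADIENT COLUMNS**: `|det(combRowsT ρ N M * (tgrad M)↾Res)| = 1` — the comb-coordinate slice is unimodular against the colour-stripped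
linearised gauge generators restricted to the residual parameters «`λ = 0` at the block roots». -/
theorem abs_det_combRowsT_mul_tgrad_eq_one (hN : 0 < N) (hρ : ∀ i, 0 ≤ ρ i ∧ ρ i < N) (hM : ∀ i, N ∣ M i) :
    |(combRowsT ρ N M * (tgrad M).submatrix id Subtype.val).det| = 1 :=
  abs_det_combRowsT_mul_eq_one hN hρ hM (tgrad M) (tgrad_combBondT hN hρ hM)

/-- [folklore] **(UNI) AT THE ROOT LABEL OF RECORD** (an2's `ρ = toSite r`, `r ∈ box (d+1) N`). -/
theorem abs_det_combRowsT_mul_tgrad_eq_one_of_box {r : Fin (d + 1) → ℕ} (hr : r ∈ box (d + 1) N) (hN : 0 < N) (hM : ∀ i, N ∣ M i) :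
    |(combRowsT (toSite r) N M * (tgrad M).submatrix id Subtype.val).det| = 1 :=
  abs_det_combRowsT_mul_tgrad_eq_one hN (toSite_mem_range hr) hM

/-- [folklore] **THE OWNER's `hU₁` WITH `c₁ = 1`** (curve form; nothing moves): `∀ᶠ u in 𝓝 0, |det(combRowsT · tgrad↾Res)| = 1`. -/
theorem eventually_abs_det_combRowsT_mul_tgrad_eq_one {r : Fin (d + 1) → ℕ} (hr : r ∈ box (d + 1) N) (hN : 0 < N) (hM : ∀ i, N ∣ M i) :
    ∀ᶠ _u in nhds (0 : ℝ), |(combRowsT (toSite r) N M * (tgrad M).submatrix id Subtype.val).det| = 1 :=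
  Filter.Eventually.of_forall fun _ => abs_det_combRowsT_mul_tgrad_eq_one_of_box hr hN hM

end Tgrad

end Summit.QuantumFields.BalabanUV.Beta.FP.TorusCombRows

end
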